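import Summits.QuantumFields.GaugeBoot.WeakCouplingDeficitRate
import Summits.QuantumFields.GaugeBoot.OneLinkLaplace
import Summits.QuantumFields.GaugeBoot.SpecialUnitaryHaarPrep
import Summits.QuantumFields.GaugeBoot.SUNWeakCouplingDeficitRate
import Summits.QuantumFields.GaugeBoot.UNPlaquetteWeakCouplingSharp
import HarnessLib

/-!
# Gauge-boot: `1 − ⟨ū_P⟩ = O(1/β)` FOR `U(N)` WITH EXPLICIT CONSTANTS AND THRESHOLD, UNIFORMLY IN THE
# VOLUME (supplement 21, part 3g — the explicit twin of part 2's sharp asymptotics)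

HONEST FRAMING (cell `pub-gaugeboot`, page 1 of every file): certified bounds on lattice
expectations at STATED coupling, gauge group, dimension and torus size; NOT a mass gap, NOT a
continuum limit, NOT a string tension, NOT large `N`; NOT Yang–Mills-summit-bearing (barriers
`FixedCouplingUltralocality`, `PerturbativeInvisibility`).  An analytic weak-coupling bound; it certifies
no number of the cell's tables.

## Content

Part 2 (`UNPlaquetteWeakCouplingSharp`) gives the SHARP law `1 − ⟨ū_P⟩ ~ N/(dβ)` for `U(N)` from
Chatterjee's free energy, but only asymptotically (`β ≥ β₀(ε)` not computed).  The sandwich of part 3e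
gives a NON-asymptotic `O(1/β)` bound at every `β ≥ 2` and every `L`, from the one-link data of `U(N)` in
dimension `2k = N²`:

* `UNRateSharp.haar_cost_le` — `Haar_{U(N)}{N − Re tr V ≤ t} ≤ 10^{N²} 2^k t^k` (part 3a's packing bound
  `HaarPacking.haar_unitaryOpBall_le` and `‖V − 1‖²_op ≤ 2(N − Re tr V)`);
* `UNRateSharp.haar_cost_ge` — `Haar_{U(N)}{N − Re tr V ≤ η} ≥ (2/N²)^k (2π+1)^{−N²} η^k` for
  `0 < η ≤ 1/2` (the tree's covering bound `haar_unitaryOpBall_ge` and `N − Re tr V ≤ N²‖V − 1‖²_op/2`);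
* ★★★ `UNRateSharp.one_sub_meanPlaquette_le` — for `N ≥ 1`, `d ≥ 2`, EVERY `L` and every tree coupling
  `β ≥ 2`: **`1 − ⟨ū_P⟩_{β,L} ≤ (2/(Nβ))(16 + (2/d)|a_N + k log 2| + (2/(d−1))|b_N| + (2k/((d−1)L)) log β)`**,
  `k = N²/2`; ★★★ `UNRateSharp.one_sub_integral_plaquette_le_of_mem_limitPoints` — the `L`-free bound at
  every infinite-volume limit point.

[folklore] (free-energy sandwich; see parts 3c–3f.)
-/

noncomputable section

open MeasureTheory Filter Topology
open scoped Matrix Matrix.Norms.L2Operator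
open Literature.MathematicalPhysics.QuantumFieldTheory
open Literature.MathematicalPhysics.QuantumLattice (LGConfig plaquetteObs infiniteVolumeLimitPoints
  unitaryFundamentalRep unitaryFundamentalRep_apply continuous_unitaryFundamentalRep)
open Literature.RepresentationTheory.CompactGroups
open Literature.Barriers.QuantumFields

namespace Summit.QuantumFields.GaugeBoot

namespace UNRateSharp

variable {N : ℕ}

/-- The `U(N)` cost set `{V : N − Re tr V ≤ t}` lies in the operator-norm ball of radius `√(2t)`. -/
theorem costSet_subset_unitaryOpBall (t : ℝ) :
    {V : Matrix.unitaryGroup (Fin N) ℂ | (N : ℝ) - ((unitaryFundamentalRep (Fin N) ℂ V).trace).re ≤ t} ⊆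
      unitaryOpBall N (Real.sqrt (2 * t)) := by
  intro V hV
  simp only [Set.mem_setOf_eq, unitaryFundamentalRep_apply] at hV
  have h := SUNRateSharp.norm_sub_one_sq_le_two_mul_cost V.2
  rw [mem_unitaryOpBall, ← Real.sqrt_sq (norm_nonneg _)]
  exact Real.sqrt_le_sqrt (by linarith)

/-- The operator-norm ball of radius `r` lies in `{N − Re tr V ≤ N² r²/2}`. -/
theorem unitaryOpBall_subset_costSet (r : ℝ) :
    unitaryOpBall N r ⊆ {V : Matrix.unitaryGroup (Fin N) ℂ |
      (N : ℝ) - ((unitaryFundamentalRep (Fin N) ℂ V).trace).re ≤ (N : ℝ) ^ 2 * r ^ 2 / 2} := by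
  intro V hV
  rw [mem_unitaryOpBall] at hV
  simp only [Set.mem_setOf_eq, unitaryFundamentalRep_apply]
  refine (SUNRateSharp.cost_le_sq_mul_norm_sq V.2).trans ?_
  have := pow_le_pow_left₀ (norm_nonneg _) hV 2
  have hN : (0 : ℝ) ≤ (N : ℝ) ^ 2 := by positivity
  nlinarith

/-- The exponent `k = N²/2 = dim U(N)/2`. -/
def kU (N : ℕ) : ℝ := ((N * N : ℕ) : ℝ) / 2

/-- `A_N = 10^{N²} 2^k`. -/
def upperConst (N : ℕ) : ℝ := 10 ^ (N * N) * 2 ^ kU N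

/-- `c_N = (2/N²)^k (2π+1)^{−N²}`. -/
def lowerConst (N : ℕ) : ℝ := (2 / (N : ℝ) ^ 2) ^ kU N * ((2 * Real.pi + 1) ^ (N * N))⁻¹

/-- `k > 0` for `N ≥ 1`. -/
theorem kU_pos (hN : N ≠ 0) : 0 < kU N := by
  unfold kU
  have : (1 : ℝ) ≤ ((N * N : ℕ) : ℝ) := by exact_mod_cast Nat.one_le_iff_ne_zero.2 (Nat.mul_ne_zero hN hN)
  linarith

/-- `A_N > 0`. -/
theorem upperConst_pos (N : ℕ) : 0 < upperConst N := by
  unfold upperConst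
  have := Real.rpow_pos_of_pos (show (0 : ℝ) < 2 by norm_num) (kU N)
  positivity

/-- `c_N > 0` (`N ≥ 1`). -/
theorem lowerConst_pos (hN : N ≠ 0) : 0 < lowerConst N := by
  unfold lowerConst
  have hNpos : (0 : ℝ) < N := by exact_mod_cast Nat.pos_of_ne_zero hN
  have := Real.rpow_pos_of_pos (show (0 : ℝ) < 2 / (N : ℝ) ^ 2 by positivity) (kU N)
  positivity

/-- ★ **UPPER small-ball bound for the `U(N)` one-link cost** (`N ≥ 1`): for `t > 0`,
`Haar{V : N − Re tr V ≤ t} ≤ 10^{N²} 2^k t^k`. [folklore] -/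
theorem haar_cost_le {t : ℝ} (ht : 0 < t) :
    (haarProbability (Matrix.unitaryGroup (Fin N) ℂ)).real
        {V : Matrix.unitaryGroup (Fin N) ℂ | (N : ℝ) - ((unitaryFundamentalRep (Fin N) ℂ V).trace).re ≤ t} ≤
      upperConst N * t ^ kU N := by
  haveI := SUHaar.isMulLeftInvariant_haarProbability (Matrix.unitaryGroup (Fin N) ℂ)
  set r := Real.sqrt (2 * t) with hr
  have hr0 : 0 < r := Real.sqrt_pos.2 (by linarith)
  have hmono := measureReal_mono (μ := haarProbability (Matrix.unitaryGroup (Fin N) ℂ))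
    (costSet_subset_unitaryOpBall (N := N) t) (measure_ne_top _ _)
  refine hmono.trans ?_
  have h := HaarPacking.haar_unitaryOpBall_le (haarProbability (Matrix.unitaryGroup (Fin N) ℂ)) hr0
  have h' := ENNReal.toReal_le_of_le_ofReal (by positivity) h
  refine h'.trans (le_of_eq ?_)
  have hrk : r ^ (N * N) = (2 * t) ^ kU N := by
    rw [hr, Real.sqrt_eq_rpow, ← Real.rpow_natCast, ← Real.rpow_mul (by linarith)]
    unfold kU; congr 1; ring
  rw [mul_pow, hrk, Real.mul_rpow (by norm_num) ht.le, upperConst]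
  ring

/-- ★ **LOWER small-ball bound for the `U(N)` one-link cost** (`N ≥ 1`): for `0 < η ≤ 1/2`,
`c_N η^k ≤ Haar{V : N − Re tr V ≤ η}`. [folklore] -/
theorem haar_cost_ge (hN : N ≠ 0) {η : ℝ} (hη : 0 < η) (hη1 : η ≤ 1 / 2) :
    lowerConst N * η ^ kU N ≤ (haarProbability (Matrix.unitaryGroup (Fin N) ℂ)).real
        {V : Matrix.unitaryGroup (Fin N) ℂ | (N : ℝ) - ((unitaryFundamentalRep (Fin N) ℂ V).trace).re ≤ η} := by
  haveI := SUHaar.isMulLeftInvariant_haarProbability (Matrix.unitaryGroup (Fin N) ℂ)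
  have hNpos : (0 : ℝ) < N := by exact_mod_cast Nat.pos_of_ne_zero hN
  have hN1 : (1 : ℝ) ≤ N := by exact_mod_cast Nat.one_le_iff_ne_zero.2 hN
  set r : ℝ := Real.sqrt (2 * η) / N with hr
  have hr0 : 0 < r := div_pos (Real.sqrt_pos.2 (by positivity)) hNpos
  have hr1 : r ≤ 1 := by
    have hs : Real.sqrt (2 * η) ≤ 1 := by rw [Real.sqrt_le_one]; linarith
    rw [hr, div_le_one hNpos]; linarith
  have hsub : unitaryOpBall N r ⊆ {V : Matrix.unitaryGroup (Fin N) ℂ |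
      (N : ℝ) - ((unitaryFundamentalRep (Fin N) ℂ V).trace).re ≤ η} := by
    refine (unitaryOpBall_subset_costSet (N := N) r).trans fun V hV => ?_
    simp only [Set.mem_setOf_eq] at hV ⊢
    refine hV.trans (le_of_eq ?_)
    rw [hr, div_pow, Real.sq_sqrt (by positivity)]
    field_simp
  have hmono := measureReal_mono (μ := haarProbability (Matrix.unitaryGroup (Fin N) ℂ)) hsub (measure_ne_top _ _)
  refine le_trans ?_ hmono
  have h := haar_unitaryOpBall_ge (haarProbability (Matrix.unitaryGroup (Fin N) ℂ)) hr0
  have h' := (ENNReal.ofReal_le_iff_le_toReal (measure_ne_top _ _)).1 h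
  rw [measureReal_def]
  refine le_trans ?_ h'
  have hrsq : r ^ 2 = 2 * η / (N : ℝ) ^ 2 := by
    rw [hr, div_pow, Real.sq_sqrt (by positivity)]
  have hrpow : r ^ (N * N) = (2 / (N : ℝ) ^ 2) ^ kU N * η ^ kU N := by
    have h1 : r ^ (N * N) = r ^ (((N * N : ℕ) : ℝ)) := (Real.rpow_natCast r _).symm
    have h2 : (((N * N : ℕ) : ℝ)) = 2 * kU N := by unfold kU; ring
    rw [h1, h2, Real.rpow_mul hr0.le, Real.rpow_two, hrsq, ← Real.mul_rpow (by positivity) hη.le]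
    congr 1; field_simp
  calc lowerConst N * η ^ kU N = r ^ (N * N) * ((2 * Real.pi + 1) ^ (N * N))⁻¹ := by
        rw [lowerConst, hrpow]; ring
    _ = (r / (2 * Real.pi + 1)) ^ (N * N) := by simp only [hr, div_pow]; ring
    _ ≤ (r / (2 * Real.pi + r)) ^ (N * N) := by gcongr

/-! ### The one-link hypotheses of part 3e for `U(N)` -/

/-- `a_N = log A_N + log C_k`. -/
def aU (N : ℕ) : ℝ := Real.log (upperConst N) + Real.log (Laplace.laplaceConst (kU N))

/-- `b_N = log c_N`. -/
def bU (N : ℕ) : ℝ := Real.log (lowerConst N)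

/-- The Laplace hypothesis `hz` of part 3e for `U(N)`, `N ≥ 1`. -/
theorem hz_u (hN : N ≠ 0) {β' : ℝ} (hβ' : 0 < β') :
    Real.log (∫ g, Peel.weight (unitaryFundamentalRep (Fin N) ℂ) β' g ∂(haarProbability (Matrix.unitaryGroup (Fin N) ℂ)))
      ≤ aU N - kU N * Real.log β' := by
  set ρ := unitaryFundamentalRep (Fin N) ℂ
  have hρ : Continuous ρ := continuous_unitaryFundamentalRep (Fin N) ℂ
  have hc : Measurable fun V : Matrix.unitaryGroup (Fin N) ℂ => (N : ℝ) - ((ρ V).trace).re :=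
    (continuous_const.sub (continuous_trace_re ρ hρ)).measurable
  have hc0 : ∀ V, 0 ≤ (N : ℝ) - ((ρ V).trace).re := fun V => by linarith [re_trace_le_of_continuous ρ hρ V]
  have hcM : ∀ V, (N : ℝ) - ((ρ V).trace).re ≤ 2 * N := fun V => by
    have h := CompactGroup.abs_re_trace_le_card ρ hρ V
    rw [Fintype.card_fin] at h
    linarith [(abs_le.1 h).1]
  have h := Laplace.log_integral_exp_neg_mul_le (haarProbability (Matrix.unitaryGroup (Fin N) ℂ)) hc hc0 hcM
    (upperConst_pos N) (kU_pos hN) (fun t ht => haar_cost_le ht) hβ'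
  unfold Peel.weight aU
  exact h

/-- The small-ball hypothesis `hq` of part 3e for `U(N)`, `N ≥ 1`, with `η₀ = 1/2`. -/
theorem hq_u (hN : N ≠ 0) {η : ℝ} (hη : 0 < η) (hη1 : η ≤ 1 / 2) :
    0 < (haarProbability (Matrix.unitaryGroup (Fin N) ℂ)).real
        {V : Matrix.unitaryGroup (Fin N) ℂ | (N : ℝ) - ((unitaryFundamentalRep (Fin N) ℂ V).trace).re ≤ η} ∧
      bU N + kU N * Real.log η ≤ Real.log ((haarProbability (Matrix.unitaryGroup (Fin N) ℂ)).real
        {V : Matrix.unitaryGroup (Fin N) ℂ | (N : ℝ) - ((unitaryFundamentalRep (Fin N) ℂ V).trace).re ≤ η}) := by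
  have h := haar_cost_ge hN hη hη1
  have hpos : 0 < lowerConst N * η ^ kU N := mul_pos (lowerConst_pos hN) (Real.rpow_pos_of_pos hη _)
  refine ⟨hpos.trans_le h, ?_⟩
  rw [bU, ← Real.log_rpow hη, ← Real.log_mul (lowerConst_pos hN).ne' (Real.rpow_pos_of_pos hη _).ne']
  exact Real.log_le_log hpos h

/-! ### The theorems -/

/-- ★★★ **`O(1/β)` for `U(N)` on every torus, non-asymptotic**: for `N ≥ 1`, `d ≥ 2`, EVERY torus side `L`
and every tree coupling `β ≥ 2`:
`1 − ⟨ū_P⟩_{β,L} ≤ (2/(Nβ))(16 + (2/d)|a_N + k log 2| + (2/(d−1))|b_N| + (2k/((d−1)L)) log β)`, `k = N²/2`. [folklore] -/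
theorem one_sub_meanPlaquette_le {d L : ℕ} [NeZero L] (hN : N ≠ 0) (hd : 2 ≤ d) {β : ℝ} (hβ : 2 ≤ β) :
    1 - wilsonExpectation (unitaryFundamentalRep (Fin N) ℂ) β
        (meanPlaquette (d := d) (L := L) (G := Matrix.unitaryGroup (Fin N) ℂ) (unitaryFundamentalRep (Fin N) ℂ)) ≤
      2 / (N * β) * (16 + 2 / d * |aU N + kU N * Real.log 2| + 2 / ((d : ℝ) - 1) * |bU N| +
        2 * kU N / (((d : ℝ) - 1) * L) * Real.log β) := by
  haveI : NeZero d := ⟨by omega⟩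
  haveI := UNSharp.secondCountable_unitaryGroup N
  exact DeficitRate.one_sub_meanPlaquette_le (d := d) (L := L) (unitaryFundamentalRep (Fin N) ℂ)
    (continuous_unitaryFundamentalRep (Fin N) ℂ) hN hd (k := kU N) (a := aU N) (b := bU N) (η₀ := 1 / 2)
    (by norm_num) (fun β' hβ' => hz_u hN hβ') (fun η hη hη1 => hq_u hN hη hη1) hβ (by norm_num; linarith)

/-- ★★★ **`O(1/β)` for `U(N)` at every infinite-volume limit point**: for `N ≥ 1`, `d ≥ 2`, `β ≥ 2`, every
`μ ∈ infiniteVolumeLimitPoints (unitaryFundamentalRep (Fin N) ℂ) β` and every plaquette of `ℤ^d`: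
`1 − ∫ (1/N) Re tr U_P dμ ≤ (2/(Nβ))(16 + (2/d)|a_N + k log 2| + (2/(d−1))|b_N|)`. [folklore] -/
theorem one_sub_integral_plaquette_le_of_mem_limitPoints {d : ℕ} (hN : N ≠ 0) (hd : 2 ≤ d) {β : ℝ}
    (hβ : 2 ≤ β) {μ : Measure (LGConfig d (Matrix.unitaryGroup (Fin N) ℂ))}
    (hμ : μ ∈ infiniteVolumeLimitPoints (d := d) (unitaryFundamentalRep (Fin N) ℂ) β)
    (x : Literature.Probability.LatticeModels.Site d) {i j : Fin d} (hij : i ≠ j) :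
    1 - ∫ U, (N : ℝ)⁻¹ * plaquetteObs (unitaryFundamentalRep (Fin N) ℂ) x i j U ∂μ ≤
      2 / (N * β) * (16 + 2 / d * |aU N + kU N * Real.log 2| + 2 / ((d : ℝ) - 1) * |bU N|) := by
  haveI : NeZero d := ⟨by omega⟩
  haveI := UNSharp.secondCountable_unitaryGroup N
  exact DeficitRate.one_sub_integral_plaquette_le_of_mem_limitPoints (d := d) (unitaryFundamentalRep (Fin N) ℂ)
    (continuous_unitaryFundamentalRep (Fin N) ℂ) hN hd (k := kU N) (a := aU N) (b := bU N) (η₀ := 1 / 2)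
    (by norm_num) (fun β' hβ' => hz_u hN hβ') (fun η hη hη1 => hq_u hN hη hη1) hβ (by norm_num; linarith) hμ x hij

end UNRateSharp

end Summit.QuantumFields.GaugeBoot

end
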